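import Summits.BirchSwinnertonDyer.Rank1Residual.Additive.GordDescent
import Summits.BirchSwinnertonDyer.Rank1Residual.AdditivePotMult.OneSided
import HarnessLib

/-!
# X4♯(G-ord), defect 2, analytic rank 0: the relocated missing input is ONE INEQUALITY (the announced one)

HONEST FRAMING (cell `b2b-bsdres`, run/shared/lean/b2b/bsd-rank1-residual/, verbatim in every
file): the goal of the cell is to DELETE the COMBINATION-SHAPED residual classes of the
Birch–Swinnerton-Dyer formula for ALL analytic-rank `≤ 1` elliptic curves over `ℚ` — "full BSD
formula for every rank `≤ 1` curve in class `C`" assembled STRICTLY from published theorems — so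
that the rank-`≤ 1` remainder becomes exactly the CONSTRUCTION-SHAPED classes, which are TYPED
(missing-input `Prop`s), NOT attempted. This is not "finishing BSD". Sub-cell `additive-p2`
(X3/X4 at an additive prime, potentially good ORDINARY half): research route; no claim beyond the
stated classes; theorems only, no new named fact; X4♯(G-ord) stays CONSTRUCTION-SHAPED.

ONE-SIDED form of the exact relocation of `GordDescent.lean` / `GordDescentExact.lean` (the G-ord
twin of additive-p1's `OneSided.lean` for X4(M)⁰). On the rows X4 ∧ `I₀*` ∧ (twist `E^{(p*)}` good
ordinary, i.e. X4♯(G-ord) e = 2) ∧ `p > 3` ∧ non-CM ∧ (im), the twist pair is COVERED (row C2,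
Burungale–Castella–Skinner 2025 Cor. 1.3.1), so by additive-p1's defect invariance
(`padicValRat_defect_eq`: `ord_p #Ш_an − ord_p #Ш` is the same over `K = ℚ(√p*)` and over `ℚ`) each
HALF of the `p`-part relocates separately:
* `missingLowerBoundAt_iff_over_of_classX4_of_goodOrd_twist`,
  `missingUpperBoundAt_iff_over_of_classX4_of_goodOrd_twist` — lower over `ℚ` ⟺ lower over `K`,
  upper ⟺ upper;
* `bsdp_of_classX4_of_goodOrd_twist_of_lowerOver_of_kim` — **on X4♯(G-ord, e = 2) ∩ {`r_an(E) = 0`,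
  `p ≥ 5`, `ρ̄_{E,p}` onto, a modular parametrisation with `p ∤ c` (Manin), `p ∤ ∏_ℓ c_ℓ(E)`} the
  ENTIRE missing input is `MissingLowerBoundOverAt(E_K, p)`: ONE inequality
  `ord_p #Ш_an(E_K/K) ≤ ord_p #Ш(E_K/K)`** — the UPPER half over `ℚ` being Kim, Amer. J. Math. 148
  (2026) Thm. 1.8(6) at any reduction type (additive-p4's `X4RankZero.bsdp_of_missingLowerBoundAt`);
  equivalently over `ℚ` (`X4RankZero.missingPPartAt_iff_lower`): ONE inequality
  `ord_p #Ш_an(E) ≤ ord_p #Ш(E)`;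
* `missingUpperBoundOverAt_of_classX4_of_goodOrd_twist_of_kim` — on the same rows the upper half
  over `K` HOLDS (Kim transported up).

WHAT THE REMAINING INEQUALITY IS, AND ITS STATUS (HOME/b2b-bsdres-additive-p2/BSTW121C-X4GORD.md):
it is the Eisenstein-congruence (Skinner–Urban) divisibility of the cyclotomic main conjecture for
`f_E = f_{E′} ⊗ χ_K` (`E′ = E^{(p*)}` good ordinary, `K = ℚ(√p*)`, `p ∣ d_K`) — equivalently the
`ω^{(p−1)/2}`-branch of the main conjecture of `E′`. PUBLISHED: nowhere (Skinner–Urban 2014 Thm.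
3.6.4 / Wan 2015: trivial branch, `p` unramified). ANNOUNCED: Burungale–Skinner–Tian–Wan,
arXiv:2409.01350v2, Thm. 1.21(c), twist clause — "the equality also holds for the quadratic twist
`g_K := g ⊗ χ_K`, where `K/ℚ` is a quadratic field extension with `p ∣ disc(K)` so that (ram_K)" —
Kato's main conjecture, integrally, for `g_K = f_E` under `p ∤ 6N_g` ordinary, (irr_ℚ), (ram_K);
by the cell rule an announced preprint is an OPEN hypothesis, NOT an input: nothing here uses it.
Census of the rows (this seat, `census/bstw121c_census.py`, N < 2·10⁴ ‖ N < 10⁴): X4♯(G-ord, e = 2,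
`p ≥ 5`, ram) = 218 ‖ 45 pairs, of which `r = 0`: 214 ‖ 44 (all with surjective `ρ̄`), CORE-open
after the published per-pair levers 17 ‖ 3.

References: C.-H. Kim, Amer. J. Math. 148 (2026) Thm. 1.8; A. Burungale, F. Castella, C. Skinner,
IMRN 2025 Cor. 1.3.1; J. S. Milne, Invent. Math. 17 (1972) Thm. 1; T. & V. Dokchitser, Ann. of Math.
172 (2010) §2.1; C. Skinner, E. Urban, Invent. Math. 195 (2014) Thm. 3.6.4; X. Wan, Forum Math. Sigma
3 (2015) e18 §1.1; A. Burungale, C. Skinner, Y. Tian, X. Wan, arXiv:2409.01350v2 Thm. 1.21(c) (PRE);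
D. Delbourgo, Compositio Math. 113 (1998) p. 151.
-/

noncomputable section

open scoped Classical

open WeierstrassCurve Literature.NumberTheory.EllipticCurves
  Literature.NumberTheory.EllipticCurves.Rank1Residual
  Literature.NumberTheory.EllipticCurves.Rank1Residual.Typed
  Literature.NumberTheory.EllipticCurves.ModularForms
  Summit.BirchSwinnertonDyer.Rank1Residual.AdditivePotMult

namespace Summit.BirchSwinnertonDyer.Rank1Residual.Additive

variable (W : WeierstrassCurve ℚ) [W.IsElliptic] [W.IsGloballyMinimal] (p : ℕ) [hp : Fact p.Prime]
  (K : Type) [Field K] [NumberField K]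
  (Wd : WeierstrassCurve ℚ) [Wd.IsElliptic] [Wd.IsGloballyMinimal]
  (W' : WeierstrassCurve K) [W'.IsElliptic] [W'.IsGloballyMinimal]

/-! ## §1 Each half relocates separately on the Covered-twist rows of X4♯(G-ord), defect 2 -/

/-- **Lower half: over `ℚ` ⟺ over `K`, on X4♯(G-ord) ∧ `I₀*` ∧ `p > 3` ∧ non-CM ∧ (im).** With
`K = ℚ(√p*)`, `Wd` a globally minimal model of the GOOD ORDINARY twist `E^{(p*)}` of analytic rank
`≤ 1` and `W'` a globally minimal `K`-model of `E_K`: `MissingLowerBoundAt W p ↔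
MissingLowerBoundOverAt W' p`. The twist pair is row C2 (`rowC2_twist_of_classX4`, BCS 2025
Cor. 1.3.1 `hBCS`), hence `BSD(Wd,p)`; then additive-p1's `missingLowerBoundAt_iff_over` (defect
invariance; Milne 1972 `hMilne`, GZK `hGZK`, modularity `hmod`).
[cite: BurungaleCastellaSkinner2025, Cor. 1.3.1 (p. 4)] -/
theorem missingLowerBoundAt_iff_over_of_classX4_of_goodOrd_twist
    (hGZK : rank_eq_analyticRank_of_analyticRank_le_one) (hmod : hasEntireLFunction_rat)
    (hMilne : Milne1972.bsdQuotient_baseChange_quadratic)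
    (hBCS : BurungaleCastellaSkinner2025.cor131_padicValRat_bsd_rank_le_one)
    (hX : ClassX4 W p) (hcm : ¬ W.HasCM) (hp3 : 3 < p) (him : BigIm W p) (hr : W.analyticRank ≤ 1)
    (h2 : Module.finrank ℚ K = 2) (hdK : (NumberField.discr K : ℚ) = (-1 : ℚ) ^ (p / 2) * p)
    (hWd : ∃ C : VariableChange ℚ, C • W.quadraticTwist (NumberField.discr K : ℚ) = Wd)
    (hord : GoodOrd Wd p) (hrd : Wd.analyticRank ≤ 1)
    (hW' : ∃ C : VariableChange K, C • W.baseChange K = W') :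
    MissingLowerBoundAt W p ↔ MissingLowerBoundOverAt W' p := by
  have hWd' : ∃ C : VariableChange ℚ, C • W.quadraticTwist ((-1 : ℚ) ^ (p / 2) * p) = Wd := by
    rw [← hdK]; exact hWd
  have hd : BSDp Wd p :=
    RowC2.bsdp hBCS hGZK hrd (rowC2_twist_of_classX4 W p Wd hX hcm hp3 him hWd' hord)
  obtain ⟨-, hfinW⟩ := hGZK W hr
  obtain ⟨-, hfinD⟩ := hGZK Wd hrd
  obtain ⟨hshaK, hWR⟩ := hMilne W K h2 Wd hWd W' hW' hfinW hfinD
  exact missingLowerBoundAt_iff_over W p K Wd W' hmod h2 hWd hW' hfinW hfinD hshaK hWR hd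

/-- **Upper half: over `ℚ` ⟺ over `K`** on the same rows. [cite: BurungaleCastellaSkinner2025, Cor. 1.3.1 (p. 4)] -/
theorem missingUpperBoundAt_iff_over_of_classX4_of_goodOrd_twist
    (hGZK : rank_eq_analyticRank_of_analyticRank_le_one) (hmod : hasEntireLFunction_rat)
    (hMilne : Milne1972.bsdQuotient_baseChange_quadratic)
    (hBCS : BurungaleCastellaSkinner2025.cor131_padicValRat_bsd_rank_le_one)
    (hX : ClassX4 W p) (hcm : ¬ W.HasCM) (hp3 : 3 < p) (him : BigIm W p) (hr : W.analyticRank ≤ 1)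
    (h2 : Module.finrank ℚ K = 2) (hdK : (NumberField.discr K : ℚ) = (-1 : ℚ) ^ (p / 2) * p)
    (hWd : ∃ C : VariableChange ℚ, C • W.quadraticTwist (NumberField.discr K : ℚ) = Wd)
    (hord : GoodOrd Wd p) (hrd : Wd.analyticRank ≤ 1)
    (hW' : ∃ C : VariableChange K, C • W.baseChange K = W') :
    MissingUpperBoundAt W p ↔ MissingUpperBoundOverAt W' p := by
  have hWd' : ∃ C : VariableChange ℚ, C • W.quadraticTwist ((-1 : ℚ) ^ (p / 2) * p) = Wd := by
    rw [← hdK]; exact hWd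
  have hd : BSDp Wd p :=
    RowC2.bsdp hBCS hGZK hrd (rowC2_twist_of_classX4 W p Wd hX hcm hp3 him hWd' hord)
  obtain ⟨-, hfinW⟩ := hGZK W hr
  obtain ⟨-, hfinD⟩ := hGZK Wd hrd
  obtain ⟨hshaK, hWR⟩ := hMilne W K h2 Wd hWd W' hW' hfinW hfinD
  exact missingUpperBoundAt_iff_over W p K Wd W' hmod h2 hWd hW' hfinW hfinD hshaK hWR hd

/-! ## §2 Analytic rank 0, `p ≥ 5`, surjective `ρ̄`: the whole residue is ONE inequality -/

/-- **X4♯(G-ord), defect 2, analytic rank `0`, `p ≥ 5`, `ρ̄_{E,p}` onto, `p ∤ c_D · ∏ c_ℓ(E)`: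
`BSD(E,p)` from ONE inequality over `K`.** For `(E,p) ∈ X4` non-CM with `L(E,1) ≠ 0`, `p ≥ 5`,
`Surj W p` (whence (im), x9's `X9.bigIm_of_surj`), a modular parametrisation datum `D` with
`p ∤ c_D` and `p ∤ ∏_ℓ c_ℓ(W)`; `K = ℚ(√p*)`; `Wd` a globally minimal model of the good ORDINARY
twist `E^{(p*)}` (`(E,p) ∈ X4♯(G-ord)`, `classX4Gord_of_goodOrd_quadraticTwist`) of analytic rank
`≤ 1`; `W'` a globally minimal `K`-model of `E_K`: **`MissingLowerBoundOverAt W' p → BSDp W p`**.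
The UPPER half is Kim 2026 Thm. 1.8(6) (`hKim`, via `X4RankZero.bsdp_of_missingLowerBoundAt`); the
twist pair is Covered by BCS 2025 Cor. 1.3.1 (`hBCS`). The remaining inequality
`ord_p #Ш_an(E_K/K) ≤ ord_p #Ш(E_K/K)` — equivalently `ord_p #Ш_an(E) ≤ ord_p #Ш(E)` — is the
Skinner–Urban direction for `f_E = f_{E′} ⊗ χ_K` at the ramified good-ordinary datum: PUBLISHED
nowhere, ANNOUNCED in Burungale–Skinner–Tian–Wan arXiv:2409.01350v2 Thm. 1.21(c) (twist clause,
`p ∣ disc K`; an OPEN hypothesis by the cell rule, not used here).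
[cite: Kim2022StructureSelmer, Thm. 1.9 (6) (PDF p. 8)] [cite: BurungaleCastellaSkinner2025, Cor. 1.3.1 (p. 4)] -/
theorem bsdp_of_classX4_of_goodOrd_twist_of_lowerOver_of_kim
    (hKim : Kim2026.rankZero_padicValNat_sha_le_of_maninConstant)
    (hGZK : rank_eq_analyticRank_of_analyticRank_le_one) (hmod : hasEntireLFunction_rat)
    (hMilne : Milne1972.bsdQuotient_baseChange_quadratic)
    (hBCS : BurungaleCastellaSkinner2025.cor131_padicValRat_bsd_rank_le_one)
    (hX : ClassX4 W p) (hcm : ¬ W.HasCM) (hp5 : 5 ≤ p) (hrW : W.analyticRank = 0) (hsurj : Surj W p)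
    {N : ℕ} [NeZero N] (D : ModularParametrizationData W N) (hc : ¬ (p : ℤ) ∣ D.maninConstant)
    (htam : ¬ p ∣ W.tamagawaProduct)
    (h2 : Module.finrank ℚ K = 2) (hdK : (NumberField.discr K : ℚ) = (-1 : ℚ) ^ (p / 2) * p)
    (hWd : ∃ C : VariableChange ℚ, C • W.quadraticTwist (NumberField.discr K : ℚ) = Wd)
    (hord : GoodOrd Wd p) (hrd : Wd.analyticRank ≤ 1)
    (hW' : ∃ C : VariableChange K, C • W.baseChange K = W')
    (hlow : MissingLowerBoundOverAt W' p) : BSDp W p := by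
  have hlowQ : MissingLowerBoundAt W p :=
    (missingLowerBoundAt_iff_over_of_classX4_of_goodOrd_twist W p K Wd W' hGZK hmod hMilne hBCS hX
      hcm (by omega) (X9.bigIm_of_surj W p hp5 hsurj) (by rw [hrW]; exact zero_le_one) h2 hdK hWd
      hord hrd hW').mpr hlow
  exact X4RankZero.bsdp_of_missingLowerBoundAt W p hKim hGZK hmod hp5 hrW hX hsurj D hc htam hlowQ

/-- **Conversely, on the same rows the upper half over `K` already HOLDS** (Kim's upper bound over
`ℚ`, `X4RankZero.missingUpperBoundAt`, transported up by
`missingUpperBoundAt_iff_over_of_classX4_of_goodOrd_twist`): only the lower half can be missing.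
[cite: Kim2022StructureSelmer, Thm. 1.9 (6) (PDF p. 8)] [cite: BurungaleCastellaSkinner2025, Cor. 1.3.1 (p. 4)] -/
theorem missingUpperBoundOverAt_of_classX4_of_goodOrd_twist_of_kim
    (hKim : Kim2026.rankZero_padicValNat_sha_le_of_maninConstant)
    (hGZK : rank_eq_analyticRank_of_analyticRank_le_one) (hmod : hasEntireLFunction_rat)
    (hMilne : Milne1972.bsdQuotient_baseChange_quadratic)
    (hBCS : BurungaleCastellaSkinner2025.cor131_padicValRat_bsd_rank_le_one)
    (hX : ClassX4 W p) (hcm : ¬ W.HasCM) (hp5 : 5 ≤ p) (hrW : W.analyticRank = 0) (hsurj : Surj W p)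
    {N : ℕ} [NeZero N] (D : ModularParametrizationData W N) (hc : ¬ (p : ℤ) ∣ D.maninConstant)
    (htam : ¬ p ∣ W.tamagawaProduct)
    (h2 : Module.finrank ℚ K = 2) (hdK : (NumberField.discr K : ℚ) = (-1 : ℚ) ^ (p / 2) * p)
    (hWd : ∃ C : VariableChange ℚ, C • W.quadraticTwist (NumberField.discr K : ℚ) = Wd)
    (hord : GoodOrd Wd p) (hrd : Wd.analyticRank ≤ 1)
    (hW' : ∃ C : VariableChange K, C • W.baseChange K = W') :
    MissingUpperBoundOverAt W' p :=
  (missingUpperBoundAt_iff_over_of_classX4_of_goodOrd_twist W p K Wd W' hGZK hmod hMilne hBCS hX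
      hcm (by omega) (X9.bigIm_of_surj W p hp5 hsurj) (by rw [hrW]; exact zero_le_one) h2 hdK hWd
      hord hrd hW').mp
    (X4RankZero.missingUpperBoundAt W p hKim hGZK hmod hp5 hrW hX hsurj D hc htam)

/-- **The exact residue of these rows, over `ℚ`**: on X4♯(G-ord, defect 2) ∩ {`r_an = 0`, `p ≥ 5`,
surj, Manin, `p ∤ ∏ c_ℓ`}, `BSD(E,p)` ⟺ `MissingLowerBoundAt W p` ⟺ `MissingLowerBoundOverAt W' p`
(`X4RankZero.missingPPartAt_iff_lower` + §1) — the one inequality that Burungale–Skinner–Tian–Wan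
Thm. 1.21(c) announces (and nothing published supplies).
[cite: Kim2022StructureSelmer, Thm. 1.9 (6) (PDF p. 8)] [cite: BurungaleCastellaSkinner2025, Cor. 1.3.1 (p. 4)] -/
theorem bsdp_iff_lowerOver_of_classX4_of_goodOrd_twist_of_kim
    (hKim : Kim2026.rankZero_padicValNat_sha_le_of_maninConstant)
    (hGZK : rank_eq_analyticRank_of_analyticRank_le_one) (hmod : hasEntireLFunction_rat)
    (hMilne : Milne1972.bsdQuotient_baseChange_quadratic)
    (hBCS : BurungaleCastellaSkinner2025.cor131_padicValRat_bsd_rank_le_one)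
    (hX : ClassX4 W p) (hcm : ¬ W.HasCM) (hp5 : 5 ≤ p) (hrW : W.analyticRank = 0) (hsurj : Surj W p)
    {N : ℕ} [NeZero N] (D : ModularParametrizationData W N) (hc : ¬ (p : ℤ) ∣ D.maninConstant)
    (htam : ¬ p ∣ W.tamagawaProduct)
    (h2 : Module.finrank ℚ K = 2) (hdK : (NumberField.discr K : ℚ) = (-1 : ℚ) ^ (p / 2) * p)
    (hWd : ∃ C : VariableChange ℚ, C • W.quadraticTwist (NumberField.discr K : ℚ) = Wd)
    (hord : GoodOrd Wd p) (hrd : Wd.analyticRank ≤ 1)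
    (hW' : ∃ C : VariableChange K, C • W.baseChange K = W') :
    BSDp W p ↔ MissingLowerBoundOverAt W' p := by
  have hfin : Finite W.sha := (hGZK W (by rw [hrW]; exact zero_le_one)).2
  haveI := hfin
  rw [← missingLowerBoundAt_iff_over_of_classX4_of_goodOrd_twist W p K Wd W' hGZK hmod hMilne hBCS
    hX hcm (by omega) (X9.bigIm_of_surj W p hp5 hsurj) (by rw [hrW]; exact zero_le_one) h2 hdK hWd
    hord hrd hW', ← X4RankZero.missingPPartAt_iff_lower W p hKim hGZK hmod hp5 hrW hX hsurj D hc htam]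
  exact ⟨fun h => missingPPartAt_of_bsdp W p h,
    fun h => bsdp_of_missingPPartAt W p hGZK (by rw [hrW]; exact zero_le_one) h⟩

end Summit.BirchSwinnertonDyer.Rank1Residual.Additive

end
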